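import Summits.BirchSwinnertonDyer.BirchSwinnertonDyer.Theorems.ByReductionTypeAtTwoSupersingularConjATwoGoodSSGenusDoor
import Summits.BirchSwinnertonDyer.BirchSwinnertonDyer.Theorems.ByReductionTypeAtTwoAdditiveKatoFineConjASexticFieldDoor
import HarnessLib

/-!
# Route `ByReductionTypeAtTwo` (rung K4), crux `SupersingularRankZeroAtTwo` (item stmt-BirchSwinnertonDyer-19097), registry v2.12 stub 3
# `stub_fineMu`: K85 `D85.SexticDoorConjAAtTwo` OF `-imc` g33 IS A THEOREM — the sextic door `ℚ(β, ι)` on the good-supersingular minimal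
# model, in the EXACT typed shape of the crux workfile `Cruxes/SupersingularRankZeroAtTwo/D85NarrowDoorAtTwo.lean` (b6024207f9dc8f53)
# (a `--supports 19097` file; seat `bsd-2adic-t42` GEN 44, task T-85 (T85-1) of director-bsd (825)(ii); sequel of `…GoodSSGenusDoor`)

HONEST LABEL (cell `bsd-2adic`, D-0036/D-0054): THEOREMS ONLY (no definition, no named fact, no `sorry`). `sexticDoorConjAAtTwo` has the
K85 body VERBATIM as its type (so `-imc`'s glue `D85.fineMuZeroAt_two_goodSSModel_of_oddNarrowClassNumber (hK := sexticDoorConjAAtTwo)`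
elaborates by name); its `hLim2` antecedent is IDLE — the proof uses NO Lim fact (k4-w2's sextic field door
`conjA_two_of_odd_classNumber_of_unique_prime_pointField_adjoin_rat`, p723127 road: Iwasawa 1956 on `ℚ(β, ι)` + cruxlead-19573-w2's
unipotent-dévissage door p718233). The stronger hLim2-free doors keyed on the CUBIC data alone are in `…GoodSSGenusDoor`; the four
`Δ_E > 0` rows are unconditional in `…GoodSSGenusRowsTotallyReal`. Closes nothing at the `∀`-level; 19097 OPEN; BSD proved for no curve.

* §1 `existsUnique_two_mem_adjoin_pair_of_sq_eq_neg_one` — ONE prime above `2` in `ℚ(β, ι)` (`ι² = −1`) when `ℚ(β)` is a cubic field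
  with one prime above `2` (Literature `existsUnique_two_mem_of_sq_eq_neg_one`, p722472, set up on the intermediate fields
  `ℚ⟮β⟯ ≤ ℚ⟮β, ι⟯`; «odd `e`» from `odd_ramificationIdx_of_existsUnique_two_mem`); `adjoin_pair_eq_sup` — `ℚ⟮β, ι⟯ = ℚ⟮β⟯ ⊔ ℚ⟮ι⟯`.
* §2 **`sexticDoorConjAAtTwo`** — K85 verbatim: `hLim2 → ∀ a₂ a₄ a₆ [IsElliptic] (β ι), aeval β ‹2-division cubic› = 0 → ι² = −1 →
  ¬ 2 ∣ #Cl(𝓞 ℚ⟮β, ι⟯) → Rank1Residual.FineMuZeroAt ([0,a₂,1,a₄,a₆] ⊗ ℚ) 2`; and the hLim2-free form `fineMuZeroAt_two_goodSSModel_of_sextic`.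

References: [CoatesSujatha2005] Conj. A, Thm. 3.4; [Greenberg2001IwasawaPastPresent] Prop. 2.1 (Iwasawa 1956); [NeukirchANT1999] I (8.2);
tree p718233, p722472, p723127; `-imc` g33 D-imc-85 (K85).
-/

set_option autoImplicit false
-- sibling precedent (`…GoodSSGenusDoor.lean`): the directory name repeats the summit name
set_option linter.dupNamespace false

noncomputable section

open scoped Classical IntermediateField NumberField

namespace Summit.BirchSwinnertonDyer.BirchSwinnertonDyer.Theorems.AddKatoTwo

open WeierstrassCurve Field Polynomial IsDedekindDomain NumberField Literature.NumberTheory.EllipticCurves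
  Literature.NumberTheory.GaloisRepresentations Literature.NumberTheory.IwasawaTheory Literature.NumberTheory.NumberFields
  Summit.BirchSwinnertonDyer.BirchSwinnertonDyer.Theorems.AlignedTransportAtTwoTorsionPointField
  Summit.BirchSwinnertonDyer.BirchSwinnertonDyer.Theses.ByReductionTypeAtTwo

/-! ## §1 One prime above `2` in `ℚ(β, ι)` -/

section SexticCarrier

/-- `ℚ⟮β, ι⟯ = ℚ⟮β⟯ ⊔ ℚ⟮ι⟯` (Galois connection of `adjoin`). [folklore] -/
theorem adjoin_pair_eq_sup (β ι : AlgebraicClosure ℚ) :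
    IntermediateField.adjoin ℚ ({β, ι} : Set (AlgebraicClosure ℚ)) =
      IntermediateField.adjoin ℚ {β} ⊔ IntermediateField.adjoin ℚ {ι} := by
  rw [show ({β, ι} : Set (AlgebraicClosure ℚ)) = {β} ∪ {ι} from (Set.singleton_union).symm]
  exact IntermediateField.gc.l_sup

/-- `[ℚ⟮ι⟯ : ℚ] = 2` for `ι² = −1`. [folklore] -/
private theorem finrank_adjoin_sq_eq_neg_one {ι : AlgebraicClosure ℚ} (hι : ι ^ 2 = -1) (hint : IsIntegral ℚ ι) :
    Module.finrank ℚ ↥(IntermediateField.adjoin ℚ ({ι} : Set (AlgebraicClosure ℚ))) = 2 := by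
  have h4 : IsPrimitiveRoot ι 4 := by
    refine IsPrimitiveRoot.mk_of_lt ι (by norm_num) (by rw [show (4 : ℕ) = 2 * 2 by rfl, pow_mul, hι]; norm_num) ?_
    intro k hk hk4
    interval_cases k
    · rw [pow_one]; intro h1; rw [h1] at hι; norm_num at hι
    · rw [hι]; norm_num
    · rw [show (3 : ℕ) = 2 + 1 by rfl, pow_succ, hι]
      intro h; have : ι = -1 := by linear_combination -h
      rw [this] at hι; norm_num at hι
  rw [IntermediateField.adjoin.finrank hint, ← Polynomial.cyclotomic_eq_minpoly_rat h4 (by norm_num),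
    Polynomial.natDegree_cyclotomic]
  rfl

/-- **ONE prime above `2` in `ℚ(β, ι)`** (`ι² = −1`) when `ℚ(β)` has ODD degree and exactly one prime above `2` (then of odd `e`): the
Literature lemma `existsUnique_two_mem_of_sq_eq_neg_one` (p722472) set up on `ℚ⟮β⟯ ≤ ℚ⟮β, ι⟯` — `ι ∉ ℚ(β)` (a real place), so
`[ℚ(β, ι) : ℚ(β)] = 2`, Galois, with the integer `ι`; stated for `[ℚ(β):ℚ] = 3`. [cite: NeukirchANT1999, Ch. I §8 Prop. (8.2)] -/
theorem existsUnique_two_mem_adjoin_pair_of_sq_eq_neg_one {β ι : AlgebraicClosure ℚ} (hι : ι ^ 2 = -1)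
    [FiniteDimensional ℚ (IntermediateField.adjoin ℚ ({β} : Set (AlgebraicClosure ℚ)))]
    (h3 : Module.finrank ℚ (IntermediateField.adjoin ℚ ({β} : Set (AlgebraicClosure ℚ))) = 3)
    (hv : ∃! v : HeightOneSpectrum (𝓞 (IntermediateField.adjoin ℚ ({β} : Set (AlgebraicClosure ℚ)))),
      ((2 : ℕ) : 𝓞 (IntermediateField.adjoin ℚ ({β} : Set (AlgebraicClosure ℚ)))) ∈ v.asIdeal) :
    ∃ _ : NumberField (IntermediateField.adjoin ℚ ({β, ι} : Set (AlgebraicClosure ℚ))),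
      ∃! w : HeightOneSpectrum (𝓞 (IntermediateField.adjoin ℚ ({β, ι} : Set (AlgebraicClosure ℚ)))),
        ((2 : ℕ) : 𝓞 (IntermediateField.adjoin ℚ ({β, ι} : Set (AlgebraicClosure ℚ)))) ∈ w.asIdeal := by
  haveI : Fact (Nat.Prime 2) := ⟨Nat.prime_two⟩
  have hodd : Odd (Module.finrank ℚ (IntermediateField.adjoin ℚ ({β} : Set (AlgebraicClosure ℚ)))) := by rw [h3]; decide
  set E : IntermediateField ℚ (AlgebraicClosure ℚ) := IntermediateField.adjoin ℚ ({β} : Set (AlgebraicClosure ℚ)) with hE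
  set F : IntermediateField ℚ (AlgebraicClosure ℚ) := IntermediateField.adjoin ℚ ({β, ι} : Set (AlgebraicClosure ℚ)) with hF
  have hFsup : F = E ⊔ IntermediateField.adjoin ℚ ({ι} : Set (AlgebraicClosure ℚ)) := adjoin_pair_eq_sup β ι
  have hint : IsIntegral ℚ ι := by
    refine ⟨Polynomial.X ^ 2 + 1, Polynomial.monic_X_pow_add_C _ two_ne_zero, ?_⟩
    simp [hι]
  haveI : FiniteDimensional ℚ ↥(IntermediateField.adjoin ℚ ({ι} : Set (AlgebraicClosure ℚ))) :=
    IntermediateField.adjoin.finiteDimensional hint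
  haveI : FiniteDimensional ℚ ↥F := by rw [hFsup]; exact IntermediateField.finiteDimensional_sup E _
  haveI : NumberField ↥E := NumberField.mk
  haveI : NumberField ↥F := NumberField.mk
  -- `ι ∉ E` (E has a real place: odd degree), `ι ∈ F`
  have hiF : ι ∈ F := IntermediateField.subset_adjoin ℚ _ (by simp)
  have hiE : ι ∉ E := by
    intro hiE
    obtain ⟨⟨w, hw⟩⟩ := Fintype.card_pos_iff.mp (InfinitePlace.nrRealPlaces_pos_of_odd_finrank hodd)
    exact (InfinitePlace.not_isReal_iff_isComplex.mpr (FineSelmerUpstairs.isComplex_of_mem_sq_eq_neg_one ι hι E hiE w)) hw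
  -- degrees: `[F : ℚ] = 2 [E : ℚ]`
  have hEF : E ≤ F := by rw [hFsup]; exact le_sup_left
  have hlt : Module.finrank ℚ ↥E < Module.finrank ℚ ↥F := by
    refine lt_of_le_of_ne (IntermediateField.finrank_le_of_le_right hEF) fun heq => hiE ?_
    rw [IntermediateField.eq_of_le_of_finrank_eq hEF heq]; exact hiF
  have hle : Module.finrank ℚ ↥F ≤ Module.finrank ℚ ↥E * 2 := by
    have h := IntermediateField.finrank_sup_le E (IntermediateField.adjoin ℚ ({ι} : Set (AlgebraicClosure ℚ)))
    rw [finrank_adjoin_sq_eq_neg_one hι hint, ← hFsup] at h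
    exact h
  -- the relative structure `E → F`
  letI : Algebra ↥E ↥F := (IntermediateField.inclusion hEF).toRingHom.toAlgebra
  haveI : IsScalarTower ℚ ↥E ↥F := IsScalarTower.of_algebraMap_eq fun q =>
    ((IntermediateField.inclusion hEF).commutes q).symm
  haveI : Module.Finite ↥E ↥F := Module.Finite.of_restrictScalars_finite ℚ ↥E ↥F
  have hdeg : Module.finrank ↥E ↥F = 2 := by
    have htower := Module.finrank_mul_finrank ℚ ↥E ↥F
    have hpos : 0 < Module.finrank ℚ ↥E := Module.finrank_pos
    have h1 : Module.finrank ↥E ↥F ≤ 2 := by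
      by_contra h; push Not at h
      have : Module.finrank ℚ ↥E * 3 ≤ Module.finrank ℚ ↥E * Module.finrank ↥E ↥F := Nat.mul_le_mul_left _ h
      omega
    have h2' : Module.finrank ↥E ↥F ≠ 1 := by
      intro h1'; rw [h1', mul_one] at htower; omega
    have h0 : Module.finrank ↥E ↥F ≠ 0 := by
      intro h0'; rw [h0', mul_zero] at htower; omega
    omega
  haveI : Algebra.IsQuadraticExtension ↥E ↥F := ⟨hdeg⟩
  haveI : IsGalois ↥E ↥F := inferInstance
  -- the integer `x = ι ∈ 𝓞 F`, `x² = −1`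
  set y : ↥F := ⟨ι, hiF⟩ with hy
  have hy2 : y ^ 2 = -1 := Subtype.ext (by simp [hy, hι])
  have hyint : IsIntegral ℤ y := ⟨Polynomial.X ^ 2 + 1, Polynomial.monic_X_pow_add_C _ two_ne_zero, by simp [hy2]⟩
  set x : 𝓞 ↥F := ⟨y, hyint⟩ with hx
  have hx2 : x ^ 2 = -1 := by ext; simp [hx, hy2]
  have hodd' : ∀ v : HeightOneSpectrum (𝓞 ↥E), ((2 : ℕ) : 𝓞 ↥E) ∈ v.asIdeal → Odd (v.asIdeal.ramificationIdx ℤ) :=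
    fun v hv2 => odd_ramificationIdx_of_existsUnique_two_mem _ h3 hv v hv2
  exact ⟨inferInstance, existsUnique_two_mem_of_sq_eq_neg_one hdeg hx2 hv hodd'⟩

end SexticCarrier

/-! ## §2 K85 verbatim, and its hLim2-free form -/

section K85

/-- **The sextic door with NO Lim fact**: for `W = [0, a₂, 1, a₄, a₆]` elliptic, a root `β` of the `2`-division cubic
`X³ + 4a₂X² + 16a₄X + (64a₆ + 16)`, `ι² = −1`, and the ONE bit `2 ∤ #Cl(𝓞 ℚ(β, ι))`: `Rank1Residual.FineMuZeroAt (W ⊗ ℚ) 2`. KERNEL: the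
point field is `ℚ(P_β) = ℚ(β)` (GEN 43 §1), `ℚ(β, ι) = ℚ(β) ⊔ ℚ(ι)` has ONE prime above `2` (§1: `ℚ(β)` cubic with `2 = 𝔮³`), so Iwasawa
1956 gives `μ₂ = 0` along every `ℤ₂`-extension of the totally imaginary `ℚ(β, ι)` and k4-w2's door
`conjA_two_of_odd_classNumber_of_unique_prime_pointField_adjoin_rat` (w2's unipotent dévissage, p718233) concludes — NO `hLim2`.
[cite: CoatesSujatha2005, Conj. A and Thm. 3.4] [cite: Greenberg2001IwasawaPastPresent, Prop. 2.1 p. 339] -/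
theorem fineMuZeroAt_two_goodSSModel_of_sextic (a₂ a₄ a₆ : ℤ)
    [((⟨0, a₂, 1, a₄, a₆⟩ : WeierstrassCurve ℤ).baseChange ℚ).IsElliptic] {β ι : AlgebraicClosure ℚ}
    (hβ : aeval β (Cubic.toPoly ⟨1, ((4 * a₂ : ℤ) : ℚ), ((16 * a₄ : ℤ) : ℚ), ((64 * a₆ + 16 : ℤ) : ℚ)⟩) = 0) (hι : ι ^ 2 = -1)
    (hh : ¬ 2 ∣ Nat.card (ClassGroup (𝓞 ℚ⟮β, ι⟯))) :
    Literature.NumberTheory.EllipticCurves.Rank1Residual.FineMuZeroAt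
      (((⟨0, a₂, 1, a₄, a₆⟩ : WeierstrassCurve ℤ).baseChange ℚ)) 2 := by
  refine Literature.NumberTheory.EllipticCurves.Rank1Residual.ConjAAt.fineMuZeroAt (fun κ hκ ↦ ?_)
  obtain ⟨P₀, hP₀, hP₀eq⟩ := exists_geomTorsion_two_goodSSModel_eq_some a₂ a₄ a₆ hβ
  have hF := fixedField_stabilizer_goodSSModel_eq_adjoin_root a₂ a₄ a₆ hβ hP₀eq
  have hfm : (Cubic.toPoly ⟨1, ((4 * a₂ : ℤ) : ℚ), ((16 * a₄ : ℤ) : ℚ), ((64 * a₆ + 16 : ℤ) : ℚ)⟩).Monic :=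
    Cubic.monic_of_a_eq_one'
  have hβint : IsIntegral ℚ β := ⟨_, hfm, by rwa [← aeval_def]⟩
  haveI : FiniteDimensional ℚ (IntermediateField.adjoin ℚ ({β} : Set (AlgebraicClosure ℚ))) :=
    IntermediateField.adjoin.finiteDimensional hβint
  obtain ⟨_, hw⟩ := existsUnique_two_mem_adjoin_pair_of_sq_eq_neg_one hι
    (finrank_adjoin_goodSSModel_root_eq_three a₂ a₄ a₆ hβ) (existsUnique_two_mem_adjoin_goodSSModel_root a₂ a₄ a₆ hβ)
  -- the two `Algebra ℚ ℚ̄` instance paths agree up to (default-transparency) defeq: rewrite, then close by `exact`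
  have hsup : IntermediateField.fixedField (MulAction.stabilizer (absoluteGaloisGroup ℚ) P₀) ⊔
      IntermediateField.adjoin ℚ ({ι} : Set (AlgebraicClosure ℚ)) = ℚ⟮β, ι⟯ := by
    rw [hF]; exact (adjoin_pair_eq_sup β ι).symm
  refine conjA_two_of_odd_classNumber_of_unique_prime_pointField_adjoin_rat _ hP₀ hι ?_ ?_ κ hκ
  · rw [hsup]; exact hh
  · rw [hsup]; exact hw

/-- **K85 `D85.SexticDoorConjAAtTwo` IS A THEOREM — VERBATIM SHAPE** of `-imc` g33's crux workfile `D85NarrowDoorAtTwo.lean`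
(b6024207f9dc8f53): granted Lim 2017 Thm. 3.5 at `2` (IDLE here — not used), for `W = [0, a₂, 1, a₄, a₆]` elliptic, a root `β` of the
`2`-division cubic, `ι² = −1` and `2 ∤ #Cl(𝓞 ℚ⟮β, ι⟯)`: `Rank1Residual.FineMuZeroAt (W ⊗ ℚ) 2`. By `fineMuZeroAt_two_goodSSModel_of_sextic`.
[cite: CoatesSujatha2005, Conj. A and Thm. 3.4] [cite: Greenberg2001IwasawaPastPresent, Prop. 2.1 p. 339]
[cite: Lim2017FineSelmer, §3 Thm. 3.5 and Lemma 3.2] -/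
theorem sexticDoorConjAAtTwo :
    Lim2017.thm35_at_two_fineSelmerDual_moduleFinite_of_classicalMuVanishes_of_le_divisionField_four →
    ∀ (a₂ a₄ a₆ : ℤ) [((⟨0, a₂, 1, a₄, a₆⟩ : WeierstrassCurve ℤ).baseChange ℚ).IsElliptic]
      (β ι : AlgebraicClosure ℚ),
      aeval β (Cubic.toPoly ⟨1, ((4 * a₂ : ℤ) : ℚ), ((16 * a₄ : ℤ) : ℚ), ((64 * a₆ + 16 : ℤ) : ℚ)⟩) = 0 → ι ^ 2 = -1 →
      ¬ 2 ∣ Nat.card (ClassGroup (𝓞 ℚ⟮β, ι⟯)) →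
      Rank1Residual.FineMuZeroAt (((⟨0, a₂, 1, a₄, a₆⟩ : WeierstrassCurve ℤ).baseChange ℚ)) 2 :=
  fun _ a₂ a₄ a₆ _ _ _ hβ hι hh ↦ fineMuZeroAt_two_goodSSModel_of_sextic a₂ a₄ a₆ hβ hι hh

end K85

end Summit.BirchSwinnertonDyer.BirchSwinnertonDyer.Theorems.AddKatoTwo

end
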